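import Summits.CriticalPhenomena.PercolationContinuityZ3.Theorems.Transplant.FKDoubleFanSesquiConeCutA
import Summits.CriticalPhenomena.PercolationContinuityZ3.Theorems.Transplant.FKDoubleFanOneSidedConeSCross
import HarnessLib

/-!
# Double fans `K₂ ∨ P_{m+1}`: cross-positivity machinery for the RIM STEP — the spectral calculus of `T_D`, its resolvent, and the
# exponential of `T_D` on half-space duals (part A of the exact local criterion for the dressed cone `cone15`)

Helper file (`--supports stmt-CriticalPhenomena-4575`), FK sub-lane `prim-bschramm-fk-3` (gen 43); builds on p205010 (kernel theorem, internal
audit signed; external expert review pending).  No named facts, no sorries; standard axioms.  Memo `bschramm/prim-bschramm-fk-3/FAR-CROSS-XVIII.md` §2.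

`…SesquiCone` reduces the far cross-apex theorem for ALL middles to `Hyp15A q ∧ Hyp15B q`: a rim step `∧²E_r` applied to a DRESSED generator of
`cone15 q` stays in `cone15 q`.  Exactly as for the spokes (`…OneSidedConeSCross`, `…TwoSidedConeSCrossA`: `∧²BC_y ∝ exp(s·T_b)`), the rim steps form a
one-parameter semigroup: `E_r = r·I + (1−r)·D` with `D² = q·D`, so `∧²E_r = r²·Π₀ + r(r+(1−r)q)·Π₁ + (r+(1−r)q)²·Π₂` (**`opE_eq_scaleTD`**) for the
SPECTRAL PROJECTORS `Π₀, Π₁, Π₂` of the polarisation `T_D` (eigenvalues `0, q, 2q`; minimal polynomial `T(T−q)(T−2q)`; `Π₂ = T(T−q)/(2q²)` is the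
rank-one map `β ↦ (ℓ_D(β)/q²)·(a∧b)`, `Π₁ = −T(T−2q)/q²` is the explicit matrix **`projD1`**).  This file provides the `T_D` analogue of the abstract
machinery of `…OneSidedConeSCross`:
* the functional calculus **`scaleTD q r s t = r·Π₀ + s·Π₁ + t·Π₂`** (`scaleTD_one`, `scaleTD_lin`, `smul_scaleTD`, **`scaleTD_scaleTD`**,
  **`opTD_scaleTD`**, **`pairH_scaleTD`** — `T_D` and its projectors are `⟪·,·⟫_H`-symmetric, `res_sub_opTD`);
* for a family `α : X → Biv` on a set `P` with a strictly positive functional `e₀`, a bound `⟪α x, T_D e₀⟫ ≤ M⟪α x, e₀⟫`, attained minima of the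
  ratios `⟪α ·, ρ⟫/⟪α ·, e₀⟫` and CROSS-POSITIVITY of `T_D` (`⟪T_D(α x), ρ⟫ ≥ 0` whenever `ρ` is in the half-space dual `PDual` and `⟪α x, ρ⟫ = 0`):
  the dual is stable under the resolvents `(I − hT_D)⁻¹ = diag(1, (1−hq)⁻¹, (1−2hq)⁻¹)` (**`pdualD_res`**), their iterates, the exponential
  `diag(1, e^{qs}, e^{2qs})` (**`pdualD_exp`**, limit of iterated resolvents) and hence under every rim step `∧²E_r`, `0 < r ≤ 1` (**`pdualD_opE`**).
Part B (`…SesquiConeCross`) instantiates this on the closure of the normalised dressed atoms and proves `Hyp15A ∧ Hyp15B ⟺` cross-positivity of `T_D`.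
[folklore]
-/

noncomputable section

open Filter Topology

namespace Summit.CriticalPhenomena.PercolationContinuityZ3.Theorems

namespace FK

namespace ThreeApex

/-! ### The spectral calculus of `T_D` -/

/-- The spectral projector `Π₁ = −T_D(T_D − 2q)/q²` of `T_D` onto its eigenvalue-`q` subspace (rank 6), as an explicit matrix. [folklore] -/
def projD1 (q : ℝ) (β : Biv) : Biv :=
  Biv.smul (1 / q ^ 2)
    ⟨-q*β.uv + 3*q*β.ux + q*β.xy + q*β.xz + 4*β.uv - 4*β.ux - 2*β.xy - 2*β.xz - 2*β.yv - 2*β.zv,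
      q^2*β.uy - q*β.uy + q*β.uz - q*β.yz,
      q^2*β.uz + q*β.uy - q*β.uz + q*β.yz,
      q^2*β.uv - q^2*β.ux - 3*q*β.uv + 5*q*β.ux + 2*q*β.xy + 2*q*β.xz + q*β.yv + q*β.zv + 4*β.uv - 4*β.ux - 2*β.xy - 2*β.xz - 2*β.yv - 2*β.zv,
      q^2*β.ux + q^2*β.xy + 2*q*β.uv - 4*q*β.ux - 2*q*β.xy - q*β.xz - q*β.yv - 4*β.uv + 4*β.ux + 2*β.xy + 2*β.xz + 2*β.yv + 2*β.zv,
      q^2*β.ux + q^2*β.xz + 2*q*β.uv - 4*q*β.ux - q*β.xy - 2*q*β.xz - q*β.zv - 4*β.uv + 4*β.ux + 2*β.xy + 2*β.xz + 2*β.yv + 2*β.zv,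
      q^2*β.xv,
      -q^2*β.uy + q^2*β.uz + 2*q*β.uy - 2*q*β.uz + 2*q*β.yz,
      q^2*β.uv - 2*q^2*β.ux - q^2*β.xy - 4*q*β.uv + 6*q*β.ux + 3*q*β.xy + 2*q*β.xz + 2*q*β.yv + q*β.zv + 4*β.uv - 4*β.ux - 2*β.xy - 2*β.xz - 2*β.yv - 2*β.zv,
      q^2*β.uv - 2*q^2*β.ux - q^2*β.xz - 4*q*β.uv + 6*q*β.ux + 2*q*β.xy + 3*q*β.xz + q*β.yv + 2*q*β.zv + 4*β.uv - 4*β.ux - 2*β.xy - 2*β.xz - 2*β.yv - 2*β.zv⟩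

/-- The `a∧b`-coefficient of the rank-one spectral projector `Π₂ = T_D(T_D − q)/(2q²)`: `Π₂ β = (ℓ_D(β)/q²)·(a∧b)`. [folklore] -/
def coefD (q : ℝ) (β : Biv) : ℝ := formD q β / q ^ 2

/-- **The functional calculus of `T_D`**: `r·Π₀ + s·Π₁ + t·Π₂ = r·I + (s−r)·Π₁ + (t−r)·Π₂`. [folklore] -/
def scaleTD (q r s t : ℝ) (β : Biv) : Biv :=
  Biv.lin3 r β (s - r) (projD1 q β) ((t - r) * coefD q β) ⟨1, 0, 0, 1, -1, -1, 0, 0, 1, 1⟩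

/-- `diag(1,1,1) = id`. [folklore] -/
theorem scaleTD_one (q : ℝ) (β : Biv) : scaleTD q 1 1 1 β = β := by
  ext <;> simp [scaleTD, Biv.lin3, Biv.add, Biv.smul]

/-- The calculus is linear in the spectral values. [folklore] -/
theorem scaleTD_lin (q a b r s t r' s' t' : ℝ) (β : Biv) :
    Biv.add (Biv.smul a (scaleTD q r s t β)) (Biv.smul b (scaleTD q r' s' t' β)) =
      scaleTD q (a * r + b * r') (a * s + b * s') (a * t + b * t') β := by
  ext <;> simp [scaleTD, Biv.lin3, Biv.add, Biv.smul] <;> ring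

/-- Scalar multiples of a diagonal operator. [folklore] -/
theorem smul_scaleTD (q c r s t : ℝ) (β : Biv) : Biv.smul c (scaleTD q r s t β) = scaleTD q (c * r) (c * s) (c * t) β := by
  ext <;> simp [scaleTD, Biv.lin3, Biv.add, Biv.smul] <;> ring

/-- **`T_D` acts diagonally**: `T_D ∘ diag(r,s,t) = diag(0, q s, 2q t)` (`q ≠ 0`). [folklore] -/
theorem opTD_scaleTD {q : ℝ} (hq : q ≠ 0) (r s t : ℝ) (β : Biv) :
    opTD q (scaleTD q r s t β) = scaleTD q 0 (q * s) (2 * q * t) β := by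
  ext <;> simp [opTD, scaleTD, projD1, coefD, formD, Biv.lin3, Biv.add, Biv.smul] <;> field_simp <;> ring

/-- `Π₁` is linear (three-term combinations). [folklore] -/
theorem projD1_lin3 (q a b c : ℝ) (β γ δ : Biv) :
    projD1 q (Biv.lin3 a β b γ c δ) = Biv.lin3 a (projD1 q β) b (projD1 q γ) c (projD1 q δ) := by
  ext <;> simp [projD1, Biv.lin3, Biv.add, Biv.smul] <;> ring

/-- `ℓ_D` is linear (three-term combinations). [folklore] -/
theorem formD_lin3 (q a b c : ℝ) (β γ δ : Biv) :
    formD q (Biv.lin3 a β b γ c δ) = a * formD q β + b * formD q γ + c * formD q δ := by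
  simp only [formD, Biv.lin3, Biv.add, Biv.smul]; ring

/-- `Π₁` is idempotent (`q ≠ 0`). [folklore] -/
theorem projD1_projD1 {q : ℝ} (hq : q ≠ 0) (β : Biv) : projD1 q (projD1 q β) = projD1 q β := by
  ext <;> simp only [projD1, Biv.smul] <;> field_simp <;> ring

/-- `Π₁(a∧b) = 0` (`Π₁Π₂ = 0`). [folklore] -/
theorem projD1_ab (q : ℝ) : projD1 q ⟨1, 0, 0, 1, -1, -1, 0, 0, 1, 1⟩ = ⟨0, 0, 0, 0, 0, 0, 0, 0, 0, 0⟩ := by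
  ext <;> simp only [projD1, Biv.smul] <;> ring

/-- `ℓ_D ∘ Π₁ = 0` (`Π₂Π₁ = 0`). [folklore] -/
theorem formD_projD1 (q : ℝ) (β : Biv) : formD q (projD1 q β) = 0 := by
  simp only [formD, projD1, Biv.smul]; ring

/-- `ℓ_D(a∧b) = q²` (`Π₂` is a projector). [folklore] -/
theorem formD_ab (q : ℝ) : formD q ⟨1, 0, 0, 1, -1, -1, 0, 0, 1, 1⟩ = q ^ 2 := by
  simp only [formD]; ring

/-- **The diagonal operators compose multiplicatively** (`Π_iΠ_j = δ_{ij}Π_i`; `q ≠ 0`). [folklore] -/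
theorem scaleTD_scaleTD {q : ℝ} (hq : q ≠ 0) (r s t r' s' t' : ℝ) (β : Biv) :
    scaleTD q r s t (scaleTD q r' s' t' β) = scaleTD q (r * r') (s * s') (t * t') β := by
  simp only [scaleTD, coefD]
  rw [projD1_lin3, formD_lin3, projD1_projD1 hq, projD1_ab, formD_projD1, formD_ab]
  ext <;> simp [Biv.lin3, Biv.add, Biv.smul] <;> field_simp <;> ring

/-- **The Bernstein split of the rim step is the functional calculus**: `∧²E_r = r²·Π₀ + r(r+(1−r)q)·Π₁ + (r+(1−r)q)²·Π₂` (`q ≠ 0`). [folklore] -/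
theorem opE_eq_scaleTD {q : ℝ} (hq : q ≠ 0) (r : ℝ) (β : Biv) :
    opE q r β = scaleTD q (r ^ 2) (r * (r + (1 - r) * q)) ((r + (1 - r) * q) ^ 2) β := by
  ext <;> simp [opE, opTD, opWD, scaleTD, projD1, coefD, formD, Biv.lin3, Biv.add, Biv.smul] <;> field_simp <;> ring

/-- The diagonal operators are symmetric for `⟪·,·⟫_H` (as `T_D` is, `pairH_opTD`). [folklore] -/
theorem pairH_scaleTD (q r s t : ℝ) (β γ : Biv) : pairH q (scaleTD q r s t β) γ = pairH q β (scaleTD q r s t γ) := by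
  simp only [pairH, scaleTD, projD1, coefD, formD, Biv.lin3, Biv.add, Biv.smul]; ring

/-- Right-hand version of the symmetry. [folklore] -/
theorem pairH_scaleTD_right (q r s t : ℝ) (β γ : Biv) : pairH q β (scaleTD q r s t γ) = pairH q (scaleTD q r s t β) γ :=
  (pairH_scaleTD q r s t β γ).symm

/-- The pairing against `diag(r,s,t) ρ` is affine in `(s,t)`: `r·⟪β,ρ⟫ + (s−r)·⟪β,Π₁ρ⟫ + (t−r)·(ℓ_D(ρ)/q²)·⟪β,a∧b⟫`. [folklore] -/
theorem pairH_scaleTD_expand (q r s t : ℝ) (β ρ : Biv) :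
    pairH q β (scaleTD q r s t ρ) = r * pairH q β ρ + (s - r) * pairH q β (projD1 q ρ)
      + (t - r) * coefD q ρ * pairH q β ⟨1, 0, 0, 1, -1, -1, 0, 0, 1, 1⟩ := by
  simp only [pairH, scaleTD, Biv.lin3, Biv.add, Biv.smul]; ring

/-- **The resolvent identity**: `(I − h·T_D) ∘ diag(1, (1−hq)⁻¹, (1−2hq)⁻¹) = I` (`q ≠ 0`, `1 − hq ≠ 0`, `1 − 2hq ≠ 0`). [folklore] -/
theorem res_sub_opTD {q h : ℝ} (hq : q ≠ 0) (h1 : 1 - h * q ≠ 0) (h2 : 1 - 2 * h * q ≠ 0) (ρ : Biv) :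
    Biv.add (scaleTD q 1 (1 - h * q)⁻¹ (1 - 2 * h * q)⁻¹ ρ) (Biv.smul (-h) (opTD q (scaleTD q 1 (1 - h * q)⁻¹ (1 - 2 * h * q)⁻¹ ρ))) = ρ := by
  rw [opTD_scaleTD hq]
  have e := scaleTD_lin q 1 (-h) 1 (1 - h * q)⁻¹ (1 - 2 * h * q)⁻¹ 0 (q * (1 - h * q)⁻¹) (2 * q * (1 - 2 * h * q)⁻¹) ρ
  have e1 : (1 : ℝ) * 1 + -h * 0 = 1 := by ring
  have e2 : (1 : ℝ) * (1 - h * q)⁻¹ + -h * (q * (1 - h * q)⁻¹) = 1 := by field_simp; ring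
  have e3 : (1 : ℝ) * (1 - 2 * h * q)⁻¹ + -h * (2 * q * (1 - 2 * h * q)⁻¹) = 1 := by field_simp; ring
  rw [e1, e2, e3, scaleTD_one] at e
  have e0 : Biv.smul 1 (scaleTD q 1 (1 - h * q)⁻¹ (1 - 2 * h * q)⁻¹ ρ) = scaleTD q 1 (1 - h * q)⁻¹ (1 - 2 * h * q)⁻¹ ρ := by
    ext <;> simp [Biv.smul]
  rw [e0] at e
  exact e

/-! ### The abstract variational step for `T_D` and its iteration -/

section Abstract

variable {X : Type*} {q : ℝ} {P : Set X} {α : X → Biv}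

variable {e₀ : Biv} {M : ℝ} (hq : 0 < q) (he : ∀ x ∈ P, 0 < pairH q (α x) e₀) (hM : ∀ x ∈ P, pairH q (α x) (opTD q e₀) ≤ M * pairH q (α x) e₀)
  (hmin : ∀ ρ : Biv, (∃ x ∈ P, pairH q (α x) ρ < 0) →
    ∃ x₀ ∈ P, ∀ x ∈ P, pairH q (α x₀) ρ * pairH q (α x) e₀ ≤ pairH q (α x) ρ * pairH q (α x₀) e₀)
  (hcross : ∀ x ∈ P, ∀ ρ : Biv, PDual q P α ρ → pairH q (α x) ρ = 0 → 0 ≤ pairH q (opTD q (α x)) ρ)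
include he hM hmin hcross

/-- **The variational step for `T_D`** (cf. `pdual_of_sub`): for `0 < h`, `h·M < 1`, if `ρ − h·T_D ρ` is in the dual, so is `ρ`. [folklore] -/
theorem pdualD_of_sub {h : ℝ} (hh : 0 < h) (hhM : h * M < 1) {ρ : Biv} (hρ : PDual q P α (Biv.add ρ (Biv.smul (-h) (opTD q ρ)))) :
    PDual q P α ρ := by
  by_contra hneg
  simp only [PDual, not_forall, not_le] at hneg
  obtain ⟨x₁, hx₁, hneg₁⟩ := hneg
  obtain ⟨x₀, hx₀, hmin₀⟩ := hmin ρ ⟨x₁, hx₁, hneg₁⟩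
  set E := pairH q (α x₀) e₀ with hE
  set R := pairH q (α x₀) ρ with hR
  have hE0 : 0 < E := he x₀ hx₀
  have hR0 : R < 0 := by
    have h1 := hmin₀ x₁ hx₁
    have h2 : pairH q (α x₁) ρ * E < 0 := mul_neg_of_neg_of_pos hneg₁ hE0
    nlinarith [he x₁ hx₁]
  set ρ' : Biv := Biv.add ρ (Biv.smul (-(R / E)) e₀) with hρ'
  have hρ'dual : PDual q P α ρ' := by
    intro x hx
    rw [hρ', pairH_add_right', pairH_smul_right']
    have h1 := hmin₀ x hx
    have : R / E * pairH q (α x) e₀ ≤ pairH q (α x) ρ := by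
      rw [div_mul_eq_mul_div, div_le_iff₀ hE0]; linarith
    linarith
  have hρ'zero : pairH q (α x₀) ρ' = 0 := by
    rw [hρ', pairH_add_right', pairH_smul_right']; field_simp; ring
  have hcr := hcross x₀ hx₀ ρ' hρ'dual hρ'zero
  rw [hρ', pairH_add_right', pairH_smul_right'] at hcr
  have hsub := hρ x₀ hx₀
  rw [pairH_add_right', pairH_smul_right', ← pairH_opTD] at hsub
  have hMe : pairH q (opTD q (α x₀)) e₀ ≤ M * E := by rw [pairH_opTD]; exact hM x₀ hx₀
  have hRE : R / E < 0 := div_neg_of_neg_of_pos hR0 hE0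
  have h3 : R * M ≤ R / E * pairH q (opTD q (α x₀)) e₀ := by
    have := mul_le_mul_of_nonpos_left hMe hRE.le
    calc R * M = R / E * (M * E) := by field_simp
      _ ≤ R / E * pairH q (opTD q (α x₀)) e₀ := this
  have h4 : R * M ≤ pairH q (opTD q (α x₀)) ρ := by linarith
  have h5 : h * pairH q (opTD q (α x₀)) ρ ≤ R := by linarith
  have h6 : h * (R * M) ≤ R := le_trans (mul_le_mul_of_nonneg_left h4 hh.le) h5
  nlinarith

include hq

/-- **Resolvent stability of the dual**: `ρ ∈ dual ⟹ diag(1, (1−hq)⁻¹, (1−2hq)⁻¹) ρ ∈ dual` (`0 < h`, `2hq < 1`, `hM < 1`). [folklore] -/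
theorem pdualD_res {h : ℝ} (hh : 0 < h) (hh2 : 2 * h * q < 1) (hhM : h * M < 1) {ρ : Biv} (hρ : PDual q P α ρ) :
    PDual q P α (scaleTD q 1 (1 - h * q)⁻¹ (1 - 2 * h * q)⁻¹ ρ) := by
  have h1 : 1 - h * q ≠ 0 := by intro e; nlinarith [mul_pos hh hq]
  have h2 : 1 - 2 * h * q ≠ 0 := by intro e; linarith
  refine pdualD_of_sub he hM hmin hcross hh hhM ?_
  rw [res_sub_opTD hq.ne' h1 h2]; exact hρ

/-- Iterated resolvents: the dual is stable under `diag(1, (1−hq)⁻ⁿ, (1−2hq)⁻ⁿ)`. [folklore] -/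
theorem pdualD_res_pow {h : ℝ} (hh : 0 < h) (hh2 : 2 * h * q < 1) (hhM : h * M < 1) {ρ : Biv} (hρ : PDual q P α ρ) (n : ℕ) :
    PDual q P α (scaleTD q 1 ((1 - h * q)⁻¹ ^ n) ((1 - 2 * h * q)⁻¹ ^ n) ρ) := by
  induction n with
  | zero => simpa [scaleTD_one] using hρ
  | succ n ih =>
    have := pdualD_res hq he hM hmin hcross hh hh2 hhM ih
    rw [scaleTD_scaleTD hq.ne'] at this
    simpa [pow_succ, mul_comm] using this

/-- **The exponential of `T_D`**: the dual is stable under `diag(1, e^{qs}, e^{2qs})` for every `s ≥ 0` (limit of iterated resolvents with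
`h = s/n`). [folklore] -/
theorem pdualD_exp (hM0 : 0 < M) {s : ℝ} (hs : 0 ≤ s) {ρ : Biv} (hρ : PDual q P α ρ) :
    PDual q P α (scaleTD q 1 (Real.exp (q * s)) (Real.exp (2 * q * s)) ρ) := by
  rcases hs.eq_or_lt with rfl | hs0
  · intro x hx; simpa [scaleTD_one] using hρ x hx
  intro x hx
  have hA : Tendsto (fun n : ℕ => ((1 + -(q * s) / (n : ℝ)) ^ n)⁻¹) atTop (𝓝 (Real.exp (q * s))) := by
    have := (Real.tendsto_one_add_div_pow_exp (-(q * s))).inv₀ (Real.exp_pos _).ne'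
    simpa [Real.exp_neg] using this
  have hB : Tendsto (fun n : ℕ => ((1 + -(2 * q * s) / (n : ℝ)) ^ n)⁻¹) atTop (𝓝 (Real.exp (2 * q * s))) := by
    have := (Real.tendsto_one_add_div_pow_exp (-(2 * q * s))).inv₀ (Real.exp_pos _).ne'
    simpa [Real.exp_neg] using this
  have hlim : Tendsto (fun n : ℕ => pairH q (α x) (scaleTD q 1 (((1 + -(q * s) / (n : ℝ)) ^ n)⁻¹) (((1 + -(2 * q * s) / (n : ℝ)) ^ n)⁻¹) ρ))
      atTop (𝓝 (pairH q (α x) (scaleTD q 1 (Real.exp (q * s)) (Real.exp (2 * q * s)) ρ))) := by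
    simp only [pairH_scaleTD_expand]
    exact ((tendsto_const_nhds).add ((hA.sub_const 1).mul_const _)).add (((hB.sub_const 1).mul_const _).mul_const _)
  refine ge_of_tendsto hlim ?_
  have hsn : Tendsto (fun n : ℕ => s / (n : ℝ)) atTop (𝓝 0) := tendsto_const_div_atTop_nhds_zero_nat s
  have hev1 : ∀ᶠ n : ℕ in atTop, s / (n : ℝ) < min (1 / (2 * q)) (1 / M) :=
    (tendsto_order.1 hsn).2 _ (lt_min (by positivity) (by positivity))
  have hev2 : ∀ᶠ n : ℕ in atTop, 0 < n := eventually_gt_atTop 0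
  filter_upwards [hev1, hev2] with n hn1 hn2
  have hnpos : (0 : ℝ) < n := by exact_mod_cast hn2
  have hh : 0 < s / (n : ℝ) := div_pos hs0 hnpos
  have hh2 : 2 * (s / (n : ℝ)) * q < 1 := by
    have h' : s / (n : ℝ) < 1 / (2 * q) := lt_of_lt_of_le hn1 (min_le_left _ _)
    rw [lt_div_iff₀ (by positivity)] at h'
    linarith
  have hhM : s / (n : ℝ) * M < 1 := by
    have : s / (n : ℝ) < 1 / M := lt_of_lt_of_le hn1 (min_le_right _ _)
    rwa [lt_div_iff₀ hM0] at this
  have key := pdualD_res_pow hq he hM hmin hcross hh hh2 hhM hρ n x hx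
  have e1 : (1 - s / (n : ℝ) * q)⁻¹ ^ n = ((1 + -(q * s) / (n : ℝ)) ^ n)⁻¹ := by rw [inv_pow]; ring_nf
  have e2 : (1 - 2 * (s / (n : ℝ)) * q)⁻¹ ^ n = ((1 + -(2 * q * s) / (n : ℝ)) ^ n)⁻¹ := by rw [inv_pow]; ring_nf
  rwa [e1, e2] at key

/-- **Rim-step stability of the dual**: under cross-positivity of `T_D` the dual is stable under every `∧²E_r`, `0 < r ≤ 1`
(`∧²E_r = r²·diag(1, μ/r, (μ/r)²)`, `μ = r + (1−r)q ≥ r`). [folklore] -/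
theorem pdualD_opE (hM0 : 0 < M) {r : ℝ} (hr0 : 0 < r) (hr1 : r ≤ 1) {ρ : Biv} (hρ : PDual q P α ρ) :
    PDual q P α (opE q r ρ) := by
  have hμr : r ≤ r + (1 - r) * q := by nlinarith [sub_nonneg.2 hr1, hq.le]
  have hμ0 : 0 < r + (1 - r) * q := lt_of_lt_of_le hr0 hμr
  set s : ℝ := Real.log ((r + (1 - r) * q) / r) / q with hs
  have hs0 : 0 ≤ s := div_nonneg (Real.log_nonneg ((one_le_div hr0).2 hμr)) hq.le
  have hexp : Real.exp (q * s) = (r + (1 - r) * q) / r := by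
    rw [hs, mul_div_cancel₀ _ hq.ne', Real.exp_log (div_pos hμ0 hr0)]
  have hexp2 : Real.exp (2 * q * s) = ((r + (1 - r) * q) / r) ^ 2 := by
    rw [show 2 * q * s = q * s + q * s by ring, Real.exp_add, hexp, sq]
  have key := (pdualD_exp hq he hM hmin hcross hM0 hs0 hρ).smul (sq_nonneg r)
  rw [hexp, hexp2, smul_scaleTD] at key
  have e1 : r ^ 2 * 1 = r ^ 2 := by ring
  have e2 : r ^ 2 * ((r + (1 - r) * q) / r) = r * (r + (1 - r) * q) := by field_simp
  have e3 : r ^ 2 * ((r + (1 - r) * q) / r) ^ 2 = (r + (1 - r) * q) ^ 2 := by field_simp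
  rw [e1, e2, e3, ← opE_eq_scaleTD hq.ne'] at key
  exact key

end Abstract

end ThreeApex

end FK

end Summit.CriticalPhenomena.PercolationContinuityZ3.Theorems
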